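import Summits.AtomisticToContinuum.BoseEinsteinCondensation.Theorems.BECThomsonPrincipleGDTransferSeededEnergyUpperL1
import Summits.AtomisticToContinuum.BoseEinsteinCondensation.Theorems.BECThomsonPrincipleGDTransferSeededAEDilationL1
import Summits.AtomisticToContinuum.BoseEinsteinCondensation.Theorems.BECThomsonPrincipleGDTransferSeededCompactLimitAE
import Summits.AtomisticToContinuum.BoseEinsteinCondensation.Theorems.BECThomsonPrincipleGDTransferSeededDilateCompactL1
import Summits.AtomisticToContinuum.BoseEinsteinCondensation.Theorems.BECThomsonPrincipleGDTransferSeededLocalConstancyL1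

/-!
# Route `BECThomsonPrinciple`, crux `GDTransfer` (stmt-AtomisticToContinuum-9482), line `seeded-continuity` —
# skeleton v8 CLOSED modulo the seed and the Born-infinite rest: periodic BEC for every integrable profile

Supports (does not close) stmt-AtomisticToContinuum-9482.  Composition file of skeleton v8 (lead c4): the five
stubs of the compactness transport are LANDED — `stub_energyUpperL1` (U), `stub_aeDilationL1` (A),
`stub_compactLimitAE` (C), `stub_dilateCompactL1` (D), `stub_localConstancyL1` (L) — so the glue
`GDTransfer_of_compact` (…SeededCompactDefs p162740) specialises to:

* `integrable_periodicBEC_of_seed` — **given the seed, Gaussian domination implies periodic BEC for every admissible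
  profile that is finite on `[0, ∞)` with integrable lift** (Fournais' Assumption 1.1; every Born-finite profile —
  soft cores `r^{-α}𝟙[r ≤ R]` with `α < 3` included; v7 had `α < 3/2`);
* `essIntegrable_periodicBEC_of_seed` — the same for every admissible profile with `∫_{ℝ³} v(|x|) dx < ∞`
  (`isEssIntegrableProfile_iff` + `stub_roughNull`);
* `GDTransfer_of_seed_of_nonIntegrableRest` — **the crux from the two remaining registered stubs**: the SEED
  `stub_noBalancedCat` and the Born-infinite rest `stub_nonIntegrableRest` (`∫ v(|x|) dx = ∞`: hard cores on a set of
  positive measure, non-integrable soft cores);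
* `hardCoreRest_of_nonIntegrableRest'`, `dilateCompactL1_holds`, `localConstancy_of_integrable` — v8 refines v7; the
  transport statements discharged of their hypotheses.

No `sorry`, no new definitions; the two open statements enter only as hypotheses.
-/

noncomputable section

open MeasureTheory Filter
open scoped ENNReal NNReal

namespace Summit.AtomisticToContinuum.BoseEinsteinCondensation.Cruxes.GDTransfer.Seeded

open Literature.MathematicalPhysics.QuantumManyBody.BoseGas
open Summit.AtomisticToContinuum.BoseEinsteinCondensation.Theses.BECThomsonPrinciple
open Summit.AtomisticToContinuum.BoseEinsteinCondensation.Cruxes.GDTransfer.DysonDressedWitness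
  (PeriodicBECFor gdTransfer_iff)

/-- (D) discharged: near-minimisers of the scaled potentials are `L²`-close to near-minimisers of `v`, for every
admissible profile finite on `[0, ∞)` with integrable lift (`stub_dilateCompactL1` over the landed (U), (C), (A)). -/
theorem dilateCompactL1_holds : DilateCompactL1 :=
  stub_dilateCompactL1 stub_energyUpperL1 stub_compactLimitAE stub_aeDilationL1

/-- (L) discharged: **local constancy of the law of near-minimisers in the side, for every admissible profile finite on
`[0, ∞)` with integrable lift** — hence, by exact dilation covariance, continuity in `L` of the condensed mass of
near-minimisers of the periodic `N`-body problem for every such (possibly discontinuous, unbounded) pair potential. -/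
theorem localConstancy_of_integrable (v : ℝ → ℝ≥0∞) (hv : IsRepulsiveFiniteRange v) (hi : IsIntegrableProfile v) :
    LocalConstancy v :=
  stub_localConstancyL1 dilateCompactL1_holds stub_nearMinPhaseInt stub_countLaw v hv hi.1 hi.2

/-- **Given the seed, Gaussian domination implies periodic BEC for every admissible profile that is finite on
`[0, ∞)` with integrable lift** (the connectedness assembly `stub_ivtGlue` over the landed count law, band emptiness
for integrable lifts, free corner, and local constancy by the compactness transport). -/
theorem integrable_periodicBEC_of_seed (hSeed : Sig.stub_noBalancedCat) (hG : GaussianDominationCan) :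
    ∀ v : ℝ → ℝ≥0∞, IsRepulsiveFiniteRange v → IsIntegrableProfile v → PeriodicBECFor v :=
  fun v hv hi => stub_ivtGlue stub_countLaw hSeed v hv (bandEmptiness_of_integrable hG v hv hi)
    (stub_freeCorner v hv) (localConstancy_of_integrable v hv hi)

/-- **… and for every admissible profile whose lift has finite integral over `ℝ³`** (the Born-finite class: by
`isEssIntegrableProfile_iff` such a profile is a.e. equal to an admissible integrable one, and `stub_roughNull` moves
the periodic BEC statement across a.e.-equal lifts). -/
theorem essIntegrable_periodicBEC_of_seed (hSeed : Sig.stub_noBalancedCat) (hG : GaussianDominationCan) :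
    ∀ v : ℝ → ℝ≥0∞, IsRepulsiveFiniteRange v → (∫⁻ x : Space, v ‖x‖) ≠ ⊤ → PeriodicBECFor v := by
  intro v hv hint
  obtain ⟨w, hw, hwi, hae⟩ := (isEssIntegrableProfile_iff hv).2 hint
  exact stub_roughNull v w hv hw hae (integrable_periodicBEC_of_seed hSeed hG w hw hwi)

/-- **Skeleton v8 closed modulo its two open stubs**: the crux from the SEED and the Born-infinite rest (registered
sub-goal; the five transport stubs are discharged by their landed proofs). -/
theorem GDTransfer_of_seed_of_nonIntegrableRest : Summit.AtomisticToContinuum.BoseEinsteinCondensation.Cruxes.GDTransfer.Seeded.Sig.stub_noBalancedCat → Summit.AtomisticToContinuum.BoseEinsteinCondensation.Cruxes.GDTransfer.Seeded.Sig.stub_nonIntegrableRest → Summit.AtomisticToContinuum.BoseEinsteinCondensation.Theses.BECThomsonPrinciple.GDTransfer :=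
  fun hSeed hRest => GDTransfer_of_compact hSeed stub_energyUpperL1 stub_aeDilationL1 stub_compactLimitAE
    stub_dilateCompactL1 stub_localConstancyL1 hRest

/-- v8 refines v7: the v7 rest stub follows from the v8 rest stub (its own hypotheses supply GD and the seed, which
feed `integrable_periodicBEC_of_seed`; `hardCoreRest_of_nonIntegrableRest`). -/
theorem hardCoreRest_of_nonIntegrableRest' (hRest : Sig.stub_nonIntegrableRest) : Sig.stub_hardCoreRest :=
  hardCoreRest_of_nonIntegrableRest (fun hG hSeed => integrable_periodicBEC_of_seed hSeed hG) hRest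

/-- Conversely the Born-infinite rest is implied by the crux (so it cannot be refuted short of refuting `GDTransfer`),
and so is the integrable conclusion; recorded as the pair. -/
theorem nonIntegrableRest_and_soft_of_gdTransfer (h : GDTransfer) :
    Sig.stub_nonIntegrableRest ∧ (GaussianDominationCan →
      ∀ v : ℝ → ℝ≥0∞, IsRepulsiveFiniteRange v → IsIntegrableProfile v → PeriodicBECFor v) :=
  ⟨nonIntegrableRest_of_gdTransfer h, fun hG v hv _ => (gdTransfer_iff.mp h) hG v hv⟩

end Summit.AtomisticToContinuum.BoseEinsteinCondensation.Cruxes.GDTransfer.Seeded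

end
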